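import Literature.NumberTheory.Automorphic.Liu2021.AppendixC.OmegaHomBlockSelector
import Literature.NumberTheory.Automorphic.Liu2021.AppendixC.HeckeImageProjector
import Literature.AlgebraicGeometry.Motives.AbelianVarietyQuasiIdempotentImageDual
import HarnessLib

/-!
# [Liu 2021, p. 140] the values `f′(ω^K)` are classes of the block quotient `A_K ↠ Im u₀` (d6 S2′ row 9, direction «block values are `u₀`-classes»)

Topic `NumberTheory/Automorphic/Liu2021/AppendixC`; namespace `Literature.NumberTheory.Automorphic.Liu2021.AppendixC.Sec42Data.HeckeTranslates`.
THEOREMS ONLY (no definition, no named fact, no instance, no `sorry`).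

Print, [Liu2021] p. 140 (proof of Thm. D.6 (1)): «Using Hecke operators, we may find a surjective homomorphism `ϕ : A_K → B` of abelian varieties over `E`
such that the induced map `ϕ^* : H¹_B(B, ℚ) → H¹_B(A_K, ℚ)[π^∞]` is an isomorphism.»  With `B = Im u₀` for the honest quasi-idempotent `u₀` of the block
(`1 ⊗ u₀ = d · ε`, ★ `HeckeImageProjector`) selected by ★ `OmegaHomBlockSelector` (`ε` acts as `1` on the level-`K` classes under `f′(ω^K)`), this file
proves the inclusion the S2′ body needs: every value `f′ w`, `w ∈ ω^K`, IS a transported class of `B`,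
`f′ w ∈ range (([·]_K ∘ ᵗV_ℓ(A_K ↠ Im u₀)) ⊗ ℚ̄_ℓ)` — because `ᵗV_ℓ(u₀) ⊗ 1` acts on its level-`K` preimage by `d`, and the `d`-eigenspace of
`ᵗV_ℓ(u₀)` is the range of `ᵗV_ℓ(A_K ↠ Im u₀)` (★ `AbelianVarietyQuasiIdempotentImageDual.exists_eq_dualMap_toImage_baseChange_of_mem_eigenspace`).

* `apply_mem_range_toTower_comp_dualMap_toImage_baseChange` — the statement above, from the selector conclusion for `ε` (hypothesis `hε`, produced by
  ★ `existsUnique_block_baseChange_toTower_eq'`) and `endAlgebra.of u₀ = (d : ℚ) • ε`, `d ≠ 0`.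

DICTIONARY LINE (cell `hodgecm-mathlib`, crux `HLiu418` = stmt-HodgeConjecture-24832, d6 S2′ body, conjunct (4a) of the referee repair of `BlockShape`
(bus 23:12:00Z)).  The file moves no book (HC_CM is proved only modulo the 7 printed citations until rung 0 closes).

## References
* [Liu2021] Y. Liu, *Fourier–Jacobi cycles and arithmetic relative trace formula*, Camb. J. Math. 9 (2021): p. 140 (FJcycle.tex l. 5626), p. 133 (D.3).
* [MumfordAV1970] D. Mumford, *Abelian Varieties*, §19 Thm. 3.
-/

set_option autoImplicit false

noncomputable section

open CategoryTheory NumberField Function MulAction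
open scoped TensorProduct

namespace Literature.NumberTheory.Automorphic.Liu2021.AppendixC

open Literature.AlgebraicGeometry.Motives (AbelianVariety)
open Literature.AlgebraicGeometry.Motives.AbelianVariety (rationalTateModuleMap endAlgebra rationalTateAction image toImage)

variable {F E : Type} [Field F] [NumberField F] [IsTotallyReal F] [Field E] [NumberField E] [Algebra F E]
  [IsTotallyComplex E] [Algebra.IsQuadraticExtension F E]
variable {P5 : PropC5Data F E} {isotropicAt : ℕ → Prop}

namespace Sec42Data.HeckeTranslates

variable {C : Sec42Data P5 isotropicAt} (T : C.HeckeTranslates) {ℓ : ℕ} [Fact ℓ.Prime]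
variable (K : C5.SmallLevel C.S.K₀)
  (hI : ∀ ⦃K K' : C5.SmallLevel C.S.K₀⦄ (f : K' ⟶ K), Function.Injective (rationalTateModuleMap ℓ (C.Atr f)).dualMap)
  (X : C.EtaleHeckeDatum ℓ) (hX : X.rhoEt = T.etHeckeRep ℓ) (ι : ℂ ≃+* AlgebraicClosure ℚ_[ℓ])
  {W : Type} [AddCommGroup W] [Module ℂ W] (ρW : Representation ℂ C.G W)
  {f : W →ₛₗ[(ι : ℂ →+* AlgebraicClosure ℚ_[ℓ])] AlgebraicClosure ℚ_[ℓ] ⊗[ℚ_[ℓ]] C.etaleH1Tower ℓ} (hf : f ∈ X.omegaHom ι ρW)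

include hI hX hf in
/-- **The values `f′(ω^K)` are transported classes of the block quotient `A_K ↠ Im u₀`**: if the central idempotent `ε` acts as `1` on the level-`K`
classes under `f′(ω^K)` (the selector conclusion) and `u₀` is its honest multiple (`1 ⊗ u₀ = d · ε`, `d ≠ 0`), then
`f′ w ∈ range (([·]_K ∘ ᵗV_ℓ(toImage u₀)) ⊗ ℚ̄_ℓ)` for every `w ∈ ω^K`. [cite: Liu2021, p. 140 (proof of Thm. D.6 (1), FJcycle.tex l. 5626) and p. 133 (D.3)]
[cite: MumfordAV1970, §19 Thm. 3] -/
theorem apply_mem_range_toTower_comp_dualMap_toImage_baseChange (hD : T.IsogenyDescent) {ε : (C.A K).endAlgebra}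
    (hε : ∀ w ∈ ρW.fixedPoints (K.1.1 : Subgroup C.G), ∀ x : (AlgebraicClosure ℚ_[ℓ]) ⊗[ℚ_[ℓ]] C.etaleH1 ℓ K,
      (C.toTower ℓ K).baseChange (AlgebraicClosure ℚ_[ℓ]) x = f w →
        (C.toTower ℓ K).baseChange (AlgebraicClosure ℚ_[ℓ])
          (((rationalTateAction (C.A K) ℓ ε).dualMap).baseChange (AlgebraicClosure ℚ_[ℓ]) x) = f w)
    {d : ℕ} (hd : d ≠ 0) {u₀ : C.A K ⟶ C.A K} (hu : endAlgebra.of (C.A K) u₀ = (d : ℚ) • ε)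
    {w : W} (hw : w ∈ ρW.fixedPoints (K.1.1 : Subgroup C.G)) :
    f w ∈ LinearMap.range ((C.toTower ℓ K ∘ₗ (rationalTateModuleMap ℓ (toImage u₀)).dualMap).baseChange (AlgebraicClosure ℚ_[ℓ])) := by
  -- a level-`K` preimage `x` of `f w`
  obtain ⟨x, hx⟩ := T.apply_mem_range_toTower_baseChange K hI X hX ι ρW hf hD hw
  -- `ε` fixes `x` (injectivity of `[·]_K ⊗ ℚ̄_ℓ`)
  have hjinj : Function.Injective ((C.toTower ℓ K).baseChange (AlgebraicClosure ℚ_[ℓ])) :=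
    toTower_baseChange_injective C ℓ (C.toTower_injective ℓ hI K)
  have hεx : ((rationalTateAction (C.A K) ℓ ε).dualMap).baseChange (AlgebraicClosure ℚ_[ℓ]) x = x :=
    hjinj ((hε w hw x hx).trans hx.symm)
  -- `ᵗV_ℓ(u₀) ⊗ 1 = d • (ᵗV_ℓ^ℚ ε ⊗ 1)`, so `x` is a `d`-eigenvector of `ᵗV_ℓ(u₀) ⊗ 1`
  have hVu : (rationalTateModuleMap ℓ u₀).dualMap = (d : ℚ_[ℓ]) • (rationalTateAction (C.A K) ℓ ε).dualMap := by
    rw [(C.A K).rationalTateModuleMap_eq_smul_rationalTateAction ℓ hu]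
    ext φ v
    simp only [LinearMap.dualMap_apply, LinearMap.smul_apply, map_smul, smul_eq_mul]
  have hG : ((rationalTateModuleMap ℓ u₀).dualMap).baseChange (AlgebraicClosure ℚ_[ℓ]) x = (d : ℚ_[ℓ]) • x := by
    rw [hVu, LinearMap.baseChange_smul, LinearMap.smul_apply, hεx]
  -- the `d`-eigenspace of `ᵗV_ℓ(u₀)` is the range of `ᵗV_ℓ(toImage u₀)`
  obtain ⟨F₀, hF₀, -⟩ := AbelianVariety.exists_eq_dualMap_toImage_baseChange_of_mem_eigenspace (ℓ := ℓ) u₀ hd (AlgebraicClosure ℚ_[ℓ]) x hG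
  refine ⟨F₀, ?_⟩
  rw [LinearMap.baseChange_comp, LinearMap.comp_apply, hF₀, hx]

end Sec42Data.HeckeTranslates

end Literature.NumberTheory.Automorphic.Liu2021.AppendixC

end
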